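import Summits.ResolutionOfSingularities.ResolutionOfSingularities.Theorems.WallCutBottom2
import HarnessLib

/-!
# LossExitCone — decomp-res node «LossExitCone» (lens-3 g27 «LossLayer» rev 3 addendum; critic row 220 + addendum;
LANDING ASK INBOX :1644), tree file 1/5 of the node

Content VERBATIM from file (4) `land/LossExitCone.lean` of the decomp-res lens-3 g27 node «LossLayer» rev 3 ADDENDUM
«LossExitCone» (STATUS NODE-ADDENDUM/RE-PIN 2026-08-31T13:02:33Z; critic row 220 (l.299) «LossLayer» = line (α) of
WINDOW rows 214/214b, laws landable at 0, `--kind proof --supports stmt-ResolutionOfSingularities-27367`, no aside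
switch, no route edit + the critic's addendum ruling on INBOX :1645; LANDING ASK INBOX :1644 items (4)–(6)); HOME =
run/shared/lean/pub/decomp-res; sources `HOME/decomp-res-lens-3/g27/land/LossExitCone.lean` (sha256 5d9cd97a, 412 l
= §1–§2), `land/LossExitCone2.lean` (b64a38c9, 324 l = §3/§3⁺), `land/LossExitCone3.lean` (60e238a8, 431 l = §4);
monolith `g27/LossExitCone.lean` dccd6923 (1009 l) rc 0 · 0 sorry · std axioms (lens CHECK-g27.md; writer chain
scratch re-checked on the farm). TREE NAMES (400-line cap): lens (4) = tree `LossExitCone` (§1) + `LossExitCone2`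
(§2); lens (5) `LossExitCone2.lean` = tree `LossExitCone3`; lens (6) `LossExitCone3.lean` = tree `LossExitCone4` +
`LossExitCone5`; (5)/(6) import tree `LossExitCone2`, (6) independent of (5). Same namespace
`…Theorems.LossExitCone` throughout; every declaration VERBATIM; nothing carried, no dedup deletions unless the gate
says so. Nothing here is progress on `ResolutionOfSingularities` (rung 0): hypothesis-free, port-free
run/exit/switch laws of the post-loss phase banked BY NAME toward the (R′) target `LossIsFatal.LossIsFatalDeep` of
column 27367; the column aside is untouched.

The lens header, verbatim:

> # LossExitCone — the CONE LAW along an untranslated run, the CHART-`j` EXIT LAW (X1) and the SIDE-SWITCH LAW (X2) of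
> the loss phase: RUN STATES ARE CLOSED UNDER NON-LOSS PLATEAU MOVES (hypothesis-free, port-free; all `q`, all fields)
>
> decomp-res-lens-3, gen 27 («LossLayer», supplement).  The layer transport calculus (desk files `LossIsFatalLayer*`)
> controls the `u_j^m`-LAYER of the residual polynomial along the post-loss run (`j` = the loss chart, `m` = the mass of the
> loss wall); it is blind to the EXIT of the run into the chart `j` (exit type X1 of NODE-g27 §4), because the blow-up in the
> chart `j` turns the layer into the unit factor `(u_j + β)^m`.  The exit is instead constrained by the CONE LAW of the tree
> (`ConeCut.cone_of_plateau`: on a plateau the residual form `resForm W u o` — the initial form divided by the boundary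
> monomial, dehomogenised at the chart letter and translated to the centre of the move — is a non-zero form of degree `s`).
> This file proves, over the landed `ConeCut` API only:
>
> * `coeff_translate_of_degree` — a translation does not change the top-degree coefficients (§1);
> * `apply_eq_of_untranslated_plateau` — at an UNTRANSLATED plateau move in the chart `i`, every monomial of the initial form
>   has `i`-degree exactly `r(i)` (the initial form is `u_i^{r_i}` times a form in the two other letters) (§2);
> * `resForm_succ_eq` — along two consecutive moves in the SAME chart, the second untranslated, both on the plateau, the
>   residual form is reproduced up to the unit `bUnit` of the first move: `resForm W (w+1) o' = C (bUnit W w) * resForm W w o`;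
>   in particular the residual form is an INVARIANT of an untranslated straight run (§2);
> * `exit_resForm`, `exit_resLayer`, `exit_initialForm` — **THE X1 EXIT LAW**: if a plateau move `u` goes into the chart of a
>   wall `j` of mass `m` while the boundary is `r_u = k·e_i + m·e_j` and the `u_j^m`-layer of `F_u` has the run shape
>   `coeff_D F_u = coeff_D (c · u^{k e_i + m e_j + s e_l} · V)` (`D j = m`, `c ≠ 0`; this is the conclusion of the desk law
>   `LossIsFatalLayer.run_invariant`), then the residual form of the move is the PURE POWER `resForm W u o = C
(c·V(0)) · u_l^s`,
>   i.e. `resLayer j (W.st u) o = C (c·V(0)) · (u_l − γ)^s` with `γ = W.b u l`, i.e. the initial form of `F_u` is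
>   `c·V(0) · u_i^k · u_j^m · (u_l − γ·u_j)^s` — a delayed proximity repeat onto the line `u_l = γ u_j` (§3);
> * `exit_prev_resForm` — consequently the residual form of the PREVIOUS move (the last run letter, chart `i`, any
>   translation) is already that pure power: `resForm W (u−1) o″ = C a · (u_l − γ·u_j)^s` (§3);
> * `exit_succ_layer`, `exit_succ_r`, `exit_succ_layer_kept` — **AFTER THE EXIT** the layer of `F_{u+1}` on the new wall
>   (`u_j`-degree `m₁ = s+k+m−q`) is `c·V(0) · (u_i + β)^k u_l^s` (`β = W.b u i`; the translation along `u_l` is absorbed);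
>   if the exit keeps the run wall (`β = 0`) it is the SINGLE MONOMIAL `c·V(0) · u_i^k u_j^{m₁} u_l^s` and
>   `r_{u+1} = k·e_i + m₁·e_j`: the run-stage shape AGAIN with `(m, V) ↦ (m₁, 1)` (§3⁺);
> * `switch_law`, `switch_resLayer`, `switch_initialForm` — **THE X2 SWITCH LAW**: a plateau move in the FREE chart `l` from a
>   run state (walls `i`, `j`, shade `s ≥ 1`, `c·V(0) ≠ 0`) has `W.b u j ≠ 0` (it LEAVES the loss wall — T4⁰ re-proved from
>   the cone law) and residual form `C φ₀ · u_j^s`, `φ₀ = c·V(0)/(−β_j)^s`: the initial form of `F_u` is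
>   `u^{r_u} · φ₀ · (u_j − β_j·u_l)^s`; the engine is the rigidity lemma `eq_zero_of_translate_free` (a binary form whose
>   translate by `b`, `b_j ≠ 0`, has no `u_j`-free monomial vanishes) (§4);
> * `switch_succ_layer`, `switch_succ_r`, `switch_succ_layer_kept` — **AFTER THE SWITCH** the new wall's layer is
>   `φ₀ · (u_i + β_i)^k (u_j + β_j)^m u_j^s`; if the switch keeps the run wall (`β_i = 0`) then `r_{u+1} = k·e_i + m₁·e_l` and
>   the layer is `φ₀ · u_i^k u_l^{m₁} u_j^s · (u_j + β_j)^m`: the run-stage shape AGAIN with the roles of `j` and `l`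
>   EXCHANGED and `V₁ = (u_j + β_j)^m`, `V₁(0) = β_j^m ≠ 0` (§4).
>
> UPSHOT (the EPISODE CALCULUS): from a run state every plateau move is a run letter (chart `i`, untranslated — desk law T5a),
> an exit X1, a switch X2, or a TOTAL LOSS (any move with `W.b u i ≠ 0`, or a chart-`i` move leaving the loss wall); the
> three non-loss moves return a run state with the explicit parameter update `(k, m) ↦ (k + d, m)` / `(k, s+k+m−q)` and new
> wall mass `s + k + m − q` in every case, and a total loss restarts the phase (desk files `LossIsFatalLedger` /
> `LossIsFatalLayer`: consecutive losses, proximity repeat, `layer_after_repeat`).  What is NOT here: the DEATH of the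
> episode chain ((R′) itself) — an isolation (axis-law) statement, see NODE-g27 §5 / SEED-g28.
>
> No statement of the residual programme is re-typed; the layer shape enters §3 as a HYPOTHESIS (it is supplied by the desk
> file `LossIsFatalLayer.lean`, which cannot be imported before it lands).
>
> (Landing part 1 of 3: §1–§2 of the lens file `g27/LossExitCone.lean`; §3/§3⁺ (the X1 exit laws) are
`LossExitCone2.lean` and §4 (the X2 switch laws) is `LossExitCone3.lean`, same namespace, verbatim.)
>
> (Sources: Hauser2010 §F (chart expressions, oblique polynomials); HauserPerlega2019 §2 (residual order under point
> blow-ups); CossartJannsenSaito2020 Ch. 8 (cone of the initial form); Moh1987; Perlega2022.)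

## This file

§1 `section Algebra` — exponent and translation bookkeeping (`coeff_translate_of_degree`, `translate_translate`, …).
 (The 400-line cap cuts this group into 2 files; this first part carries: `update_zero_eq_erase`,
`degree_update_zero_add`, `update_zero_of_apply_eq_zero`, `eq_of_le_of_degree_eq`, `exists_apply_lt_of_ne`,
`coeff_translate_of_degree`, `translate_translate`, `translate_C_mul_X_pow`, `X_sub_C_pow_eq_sum`,
`coeff_linear_pow_eq_zero`, `coeff_X_sub_C_pow_eq_zero`, `coeff_update_linear_pow`.)

[WRITER NOTE (decomp-res writer g14): file split only (tree files ≤ 400 lines) — cut at the node's section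
boundaries where possible (§1 | §2; §3–§3⁺ whole; §4 by the cap between two declarations with `section Switch` and
its `variable` line replayed); file-level `open` lines replayed in every part; every declaration, docstring and `/-!
## § -/` comment exactly as in the lens files.]

(Sources: Hauser2010 §F; HauserPerlega2019 §2; CossartJannsenSaito2020 Ch. 8; Moh1987; Perlega2022.)
-/

open MvPolynomial Finset
open Literature.AlgebraicGeometry.Resolution
open Literature.AlgebraicGeometry.Resolution.Hauser2010
open Literature.AlgebraicGeometry.Resolution.PointBlowup
open Literature.AlgebraicGeometry.Resolution.WeightedBlowup
open Summit.ResolutionOfSingularities.ResolutionOfSingularities.Theorems.TightDefectClasses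
open Summit.ResolutionOfSingularities.ResolutionOfSingularities.Theorems.TightDefectStrongWalks
open Summit.ResolutionOfSingularities.ResolutionOfSingularities.Theorems.ItineraryCutClasses
open Summit.ResolutionOfSingularities.ResolutionOfSingularities.Theorems.BoundaryLedger
open Summit.ResolutionOfSingularities.ResolutionOfSingularities.Theorems.ProximityCut
open Summit.ResolutionOfSingularities.ResolutionOfSingularities.Theorems.ConeCut
open Summit.ResolutionOfSingularities.ResolutionOfSingularities.Theorems.WallCutRun

namespace Summit.ResolutionOfSingularities.ResolutionOfSingularities.Theorems.LossExitCone

section Algebra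

variable {K : Type} [Field K]

/-! ## §1 Exponent and translation bookkeeping -/

/-- `E.update j 0` is `E` with the letter `j` erased. [folklore] -/
theorem update_zero_eq_erase (E : Fin 3 →₀ ℕ) (j : Fin 3) : E.update j 0 = Finsupp.erase j E := by
  classical
  ext k
  rw [Finsupp.update_apply, Finsupp.erase_apply]

/-- Degree of an erased exponent. [folklore] -/
theorem degree_update_zero_add (E : Fin 3 →₀ ℕ) (j : Fin 3) : (E.update j 0).degree + E j = E.degree := by
  rw [update_zero_eq_erase]
  exact NoJump.degree_erase_add E j

/-- An exponent vanishing at `j` is unchanged by erasing `j`. [folklore] -/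
theorem update_zero_of_apply_eq_zero {E : Fin 3 →₀ ℕ} {j : Fin 3} (h : E j = 0) : E.update j 0 = E := by
  classical
  ext k
  rw [Finsupp.update_apply]
  by_cases hk : k = j
  · rw [if_pos hk, hk, h]
  · rw [if_neg hk]

/-- Two comparable exponents of the same degree are equal. [folklore] -/
theorem eq_of_le_of_degree_eq {E A : Fin 3 →₀ ℕ} (hle : E ≤ A) (hdeg : A.degree = E.degree) : E = A := by
  have h := add_tsub_cancel_of_le hle
  have hd : (A - E).degree = 0 := by
    have := congrArg Finsupp.degree h
    rw [map_add] at this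
    omega
  rw [Finsupp.degree_eq_zero_iff] at hd
  rw [hd, add_zero] at h
  exact h

/-- Below a different exponent of at most the same degree some letter is strictly smaller. [folklore] -/
theorem exists_apply_lt_of_ne {E A : Fin 3 →₀ ℕ} (hdeg : A.degree ≤ E.degree) (hne : A ≠ E) : ∃ w, A w < E w := by
  by_contra h
  push Not at h
  have hle : E ≤ A := fun w => h w
  have hEA : E.degree ≤ A.degree := by
    have := congrArg Finsupp.degree (add_tsub_cancel_of_le hle)
    rw [map_add] at this
    omega
  exact hne (eq_of_le_of_degree_eq hle (le_antisymm hdeg hEA)).symm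

/-- **A translation does not change the top-degree coefficients:** if every monomial of `R` has degree `≤ n`, then for
`|E| = n` the coefficient of `u^E` in `R(u + b)` is that of `R`. [folklore] -/
theorem coeff_translate_of_degree (b : Fin 3 → K) (R : MvPolynomial (Fin 3) K) {n : ℕ}
    (hR : ∀ A ∈ R.support, A.degree ≤ n) {E : Fin 3 →₀ ℕ} (hE : E.degree = n) :
    coeff E (PointBlowup.translate b R) = coeff E R := by
  classical
  conv_lhs => rw [R.as_sum, PointBlowup.translate_finset_sum, coeff_sum]
  rw [Finset.sum_eq_single E]
  · exact coeff_translate_monomial_self b E (coeff E R)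
  · intro A hA hAE
    obtain ⟨w, hw⟩ := exists_apply_lt_of_ne (by rw [hE]; exact hR A hA) hAE
    exact coeff_translate_monomial_eq_zero_of_lt b A E (coeff A R) hw
  · intro hE'
    rw [coeff_translate_monomial_self, notMem_support_iff.mp hE']

/-- Composition of translations. [folklore] -/
theorem translate_translate (a b : Fin 3 → K) (G : MvPolynomial (Fin 3) K) :
    PointBlowup.translate a (PointBlowup.translate b G) = PointBlowup.translate (a + b) G := by
  unfold PointBlowup.translate
  have hfg : (fun w => (aeval fun i => (X i + C (a i) : MvPolynomial (Fin 3) K))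
      ((X w + C (b w) : MvPolynomial (Fin 3) K))) = fun i => (X i + C ((a + b) i) : MvPolynomial (Fin 3) K) := by
    funext w
    rw [map_add, MvPolynomial.aeval_X, MvPolynomial.aeval_C, MvPolynomial.algebraMap_eq, Pi.add_apply, C_add,
      add_assoc]
  have hcomp := MvPolynomial.comp_aeval (R := K) (fun i => (X i + C (b i) : MvPolynomial (Fin 3) K))
    (aeval fun i => (X i + C (a i) : MvPolynomial (Fin 3) K))
  rw [hfg] at hcomp
  rw [← hcomp, AlgHom.comp_apply]

/-- Translation of `C a · u_l^n`. [folklore] -/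
theorem translate_C_mul_X_pow (b : Fin 3 → K) (a : K) (l : Fin 3) (n : ℕ) :
    PointBlowup.translate b (C a * X l ^ n) = C a * (X l + C (b l)) ^ n := by
  unfold PointBlowup.translate
  rw [map_mul, map_pow, MvPolynomial.aeval_C, MvPolynomial.aeval_X, MvPolynomial.algebraMap_eq]

/-- Binomial expansion of `(u_l − γ)^n` as a sum of monomials. [folklore] -/
theorem X_sub_C_pow_eq_sum (l : Fin 3) (γ : K) (n : ℕ) : (X l - C γ : MvPolynomial (Fin 3) K) ^ n =
    ∑ a ∈ Finset.range (n + 1), monomial (Finsupp.single l a) (((n.choose a : ℕ) : K) * (-γ) ^ (n - a)) := by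
  rw [sub_eq_add_neg, ← C_neg, add_pow]
  refine Finset.sum_congr rfl (fun a _ => ?_)
  rw [X_pow_eq_monomial, ← C_pow, ← map_natCast (C : K →+* MvPolynomial (Fin 3) K), mul_assoc, ← map_mul,
    mul_comm, C_mul_monomial, mul_one, mul_comm]

/-- The binary form `(u_l − γ u_j)^n` has only exponents of degree `n` supported on `{j, l}`. [folklore] -/
theorem coeff_linear_pow_eq_zero (j l : Fin 3) (γ : K) {n : ℕ} {E : Fin 3 →₀ ℕ}
    (h : E.degree ≠ n ∨ ∃ w, w ≠ j ∧ w ≠ l ∧ E w ≠ 0) : coeff E ((X l - C γ * X j : MvPolynomial (Fin 3) K) ^ n) = 0 := by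
  classical
  rw [sub_eq_add_neg, ← neg_mul, ← C_neg, linear_pow_eq_sum (-γ) n, coeff_sum]
  refine Finset.sum_eq_zero (fun a ha => ?_)
  rw [Finset.mem_range] at ha
  rw [coeff_monomial, if_neg]
  intro hbin
  rcases h with h | ⟨w, hwj, hwl, hw⟩
  · apply h
    rw [← hbin, degree_binExp n a (by omega)]
  · apply hw
    rw [← hbin, binExp_apply_of_ne hwj hwl]

/-- `(u_l − γ)^n` has only exponents on the letter `l`. [folklore] -/
theorem coeff_X_sub_C_pow_eq_zero (l : Fin 3) (γ : K) {n : ℕ} {A : Fin 3 →₀ ℕ} {w : Fin 3} (hwl : w ≠ l)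
    (hw : A w ≠ 0) : coeff A ((X l - C γ : MvPolynomial (Fin 3) K) ^ n) = 0 := by
  classical
  rw [X_sub_C_pow_eq_sum, coeff_sum]
  refine Finset.sum_eq_zero (fun a _ => ?_)
  rw [coeff_monomial, if_neg]
  intro h
  apply hw
  rw [← h, Finsupp.single_eq_of_ne hwl]

/-- The coefficients of `(u_l − γ)^n` at `j`-erased exponents are those of the binary form `(u_l − γ u_j)^n`:
for `|E| = n`, `coeff_{E.update j 0} (u_l − γ)^n = coeff_E (u_l − γ·u_j)^n` (`l ≠ j`). [folklore] -/
theorem coeff_update_linear_pow {j l : Fin 3} (hlj : l ≠ j) (γ : K) {n : ℕ} {E : Fin 3 →₀ ℕ} (hE : E.degree = n) :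
    coeff (E.update j 0) ((X l - C γ) ^ n) = coeff E ((X l - C γ * X j) ^ n) := by
  classical
  by_cases hEi : ∀ w, w ≠ j → w ≠ l → E w = 0
  · have hupd : E.update j 0 = Finsupp.single l (E l) := by
      ext w
      rw [Finsupp.update_apply]
      by_cases hwj : w = j
      · rw [if_pos hwj, hwj, Finsupp.single_eq_of_ne hlj.symm]
      · rw [if_neg hwj]
        by_cases hwl : w = l
        · rw [hwl, Finsupp.single_eq_same]
        · rw [hEi w hwj hwl, Finsupp.single_eq_of_ne hwl]
    have hEj : E j = n - E l ∧ E l ≤ n := by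
      have := degree_update_zero_add E j
      rw [hupd, Finsupp.degree_single] at this
      omega
    have hbin : binExp j l n (E l) = E := by
      ext w
      unfold binExp
      rw [Finsupp.add_apply]
      by_cases hwj : w = j
      · rw [hwj, Finsupp.single_eq_same, Finsupp.single_eq_of_ne hlj.symm, add_zero, hEj.1]
      · rw [Finsupp.single_eq_of_ne hwj, zero_add]
        by_cases hwl : w = l
        · rw [hwl, Finsupp.single_eq_same]
        · rw [Finsupp.single_eq_of_ne hwl, hEi w hwj hwl]
    have hL : coeff (E.update j 0) ((X l - C γ : MvPolynomial (Fin 3) K) ^ n) =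
        ((n.choose (E l) : ℕ) : K) * (-γ) ^ (n - E l) := by
      rw [X_sub_C_pow_eq_sum, coeff_sum, Finset.sum_eq_single (E l)]
      · rw [coeff_monomial, if_pos hupd.symm]
      · intro a _ ha
        rw [coeff_monomial, if_neg]
        intro h
        apply ha
        rw [hupd] at h
        exact Finsupp.single_injective l h
      · intro h
        exact absurd (Finset.mem_range.mpr (by omega)) h
    have hR : coeff E ((X l - C γ * X j : MvPolynomial (Fin 3) K) ^ n) =
        ((n.choose (E l) : ℕ) : K) * (-γ) ^ (n - E l) := by
      rw [sub_eq_add_neg, ← neg_mul, ← C_neg, linear_pow_eq_sum (-γ) n, coeff_sum, Finset.sum_eq_single (E l)]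
      · rw [coeff_monomial, if_pos hbin]
      · intro a _ ha
        rw [coeff_monomial, if_neg]
        intro h
        apply ha
        have := congrArg (fun f => f l) h
        simpa only [binExp_apply_k hlj] using this
      · intro h
        exact absurd (Finset.mem_range.mpr (by omega)) h
    rw [hL, hR]
  · push Not at hEi
    obtain ⟨w, hwj, hwl, hw⟩ := hEi
    rw [coeff_linear_pow_eq_zero j l γ (Or.inr ⟨w, hwj, hwl, hw⟩)]
    refine coeff_X_sub_C_pow_eq_zero l γ hwl ?_
    rw [Finsupp.update_apply, if_neg hwj]
    exact hw

end Algebra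

end Summit.ResolutionOfSingularities.ResolutionOfSingularities.Theorems.LossExitCone
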